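import Literature.AlgebraicGeometry.Frobenioids.ArithmeticRealificationPicDegree
import Literature.AlgebraicGeometry.Frobenioids.ArithmeticDegreePullback
import HarnessLib

/-!
# Frobenioids I, Thm. 6.4 (i)/(ii): `δ` under pull-back — `δ_X ∘ Pic(f) = [L_X : L_Y] · δ_Y` for THE realified
# arithmetic Frobenioid `C_{K/F}^rlf`

Mochizuki, *The geometry of Frobenioids I*, Kyushu J. Math. **62** (2008), Thm. 6.4 (i) p. 114 ("`deg^arith_L`
determines an isomorphism of groups `δ_A : Pic_Φ(A) ⥲ ℝ`") and (ii) p. 114 ("there exists an element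
`deg(Ψ^rlf) ∈ ℝ_{>0}` such that for all Frobenius-trivial `A₁ ∈ Ob(C₁)`, `A₂ ∈ Ob(C₂)` such that `A₂ = Ψ^rlf(A₁)` …
the composite of `δ_{A₂}` with the isomorphism `Pic_Φ(A₁) ⥲ Pic_Φ(A₂)` determined by `Ψ^rlf` … is equal to
`deg(Ψ^rlf) · δ_{A₁}`") — ONE constant for all objects over the
connected base `D`, which rests on how the `δ_A` behave along the morphisms of `D`: `deg^arith_L(σ^* d) = [L:M] ·
deg^arith_M(d)` (Ex. 6.3 p. 113, the monoid `Φ` on `D`) [cite: MochizukiFrdI2008, Thm. 6.4 (ii) p.114]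
[cite: MochizukiFrdI2008, Ex. 6.3 p.113].

PROOF-ONLY (cell abc-iut; L1-lead R112 (1) row **E4 «δ at THE instance»**, scaling half at the `Pic` level:
"`δ ∘ picPull σ = [L:M] • δ`"; seat abc-iut-L1-d2).  For `f : X ⟶ Y` in `D = FinSubextCat F K` (a field embedding
`σ_f : L_Y → L_X`), THE realification data `R = RealificationData.canonical Φ _`, THE `ℝ · Φ^birat`, abc-iut-L1-t5's
`picPull f : Pic(Y) → Pic(X)` (induced by `Φ^rlf(f) = rlfMap`, Prop. 5.3), and the descended degrees `δ_X`, `δ_Y` of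
`ArithmeticRealificationPicDegree.lean` (any `d_X, d_Y` extending `deg^arith`, any `δ_X, δ_Y` over them):
* `arith_rlfDegree_comp_rlfMap` — `d_X ∘ Φ^rlf(f) = d_Y^{[L_X:L_Y]}` on `Φ(L_Y)^rlf` (uniqueness of `ℝ_{≥0}`-valued
  extensions, `IsPerfFactorial.Rlf.existsUnique_hom_extending`, + `arithDegree_toArithDivisor_pullback_ringHom`);
* **`arith_picDegree_picPull`** — `δ_X (Pic(f) x) = (δ_Y x)^{[L_X:L_Y]}`, additively
  `arith_toAdd_picDegree_picPull : δ_X (Pic(f) x) = [L_X:L_Y] · δ_Y x`.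
-/

noncomputable section

open scoped NNReal

namespace Literature.AlgebraicGeometry.Frobenioids

open CategoryTheory Opposite Function NumberField Literature.AnabelianGeometry.EtaleTheta

namespace ArithRlfPic

variable {F : Type} [Field F] [NumberField F] {K : Type} [Field K] [Algebra F K]
  (hΦ : PreFrobenioid.IsPerfFactorialOn (arithDivisorFunctor F K)) {X Y : FinSubextCat F K} (f : X ⟶ Y)
  (dX : (PreFrobenioid.IsPerfFactorialOn.op hΦ (op X)).Rlf →* Multiplicative ℝ≥0)
  (hdX : ∀ D : EffArithDivisor X.L,
    ((Multiplicative.toAdd (dX ((PreFrobenioid.IsPerfFactorialOn.op hΦ (op X)).toRealification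
      (Perfection.of _ (Multiplicative.ofAdd D)))) : ℝ≥0) : ℝ) =
      arithDegree X.L (EffArithDivisor.toArithDivisor X.L D))
  (dY : (PreFrobenioid.IsPerfFactorialOn.op hΦ (op Y)).Rlf →* Multiplicative ℝ≥0)
  (hdY : ∀ D : EffArithDivisor Y.L,
    ((Multiplicative.toAdd (dY ((PreFrobenioid.IsPerfFactorialOn.op hΦ (op Y)).toRealification
      (Perfection.of _ (Multiplicative.ofAdd D)))) : ℝ≥0) : ℝ) =
      arithDegree Y.L (EffArithDivisor.toArithDivisor Y.L D))
include hdX hdY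

/-- **`d_X ∘ Φ^rlf(f) = d_Y^{[L_X : L_Y]}` on `Φ(L_Y)^rlf`**: both are `ℝ_{≥0}`-valued homomorphisms extending
`D ↦ deg^arith_{L_X}(σ_f^* D) = [L_X:L_Y] · deg^arith_{L_Y}(D)` (`arithDegree_toArithDivisor_pullback_ringHom`), hence
equal by the uniqueness of such extensions (`IsPerfFactorial.Rlf.existsUnique_hom_extending`).
[cite: MochizukiFrdI2008, Ex. 6.3 p.113] -/
theorem arith_rlfDegree_comp_rlfMap (a : (PreFrobenioid.IsPerfFactorialOn.op hΦ (op Y)).Rlf) :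
    dX (rlfMap (arithDivisorFunctor F K) (PreFrobenioid.IsPerfFactorialOn.op hΦ) f.op a) =
      dY a ^ (letI := f.toAlgHom.toRingHom.toAlgebra; Module.finrank Y.L X.L) := by
  -- the two homomorphisms `Φ(L_Y)^rlf → ℝ_{≥0}`
  have hu := IsPerfFactorial.Rlf.existsUnique_hom_extending (PreFrobenioid.IsPerfFactorialOn.op hΦ (op Y))
    ArchFrd.Thm36Sub.supports_R_nnreal
    ((dX.comp (rlfMap (arithDivisorFunctor F K) (PreFrobenioid.IsPerfFactorialOn.op hΦ) f.op)).comp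
      ((PreFrobenioid.IsPerfFactorialOn.op hΦ (op Y)).toRealification.comp (Perfection.of _)))
  have key : dX.comp (rlfMap (arithDivisorFunctor F K) (PreFrobenioid.IsPerfFactorialOn.op hΦ) f.op) =
      (powMonoidHom (letI := f.toAlgHom.toRingHom.toAlgebra; Module.finrank Y.L X.L)).comp dY := by
    refine hu.unique rfl (MonoidHom.ext fun D => ?_)
    show dY ((PreFrobenioid.IsPerfFactorialOn.op hΦ (op Y)).toRealification (Perfection.of _ D)) ^ _ =
      dX (rlfMap (arithDivisorFunctor F K) (PreFrobenioid.IsPerfFactorialOn.op hΦ) f.op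
        ((PreFrobenioid.IsPerfFactorialOn.op hΦ (op Y)).toRealification (Perfection.of _ D)))
    rw [rlfMap_toRealification_of]
    apply Multiplicative.toAdd.injective
    apply NNReal.coe_injective
    rw [toAdd_pow, nsmul_eq_mul, NNReal.coe_mul, NNReal.coe_natCast, ← ofAdd_toAdd D, hdY]
    have hX := hdX (EffArithDivisor.pullback f.toAlgHom.toRingHom (Multiplicative.toAdd D))
    rw [arithDegree_toArithDivisor_pullback_ringHom] at hX
    exact hX.symm
  exact DFunLike.congr_fun key a

variable
  (δX : ((RealificationData.canonical (arithDivisorFunctor F K) (PreFrobenioid.IsPerfFactorialOn.op hΦ)).realSpan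
        (PreFrobenioid.biratSubfunctor
          (ModelFrobenioid.toElem (arithDivisorFunctor F K) (unitsFunctor F K) (divNatTrans F K)))).Pic X →*
      Multiplicative ℝ)
  (hδX : δX.comp (QuotientGroup.mk' _) =
    (Algebra.GrothendieckGroup.lift
      (NNReal.toRealHom.toAddMonoidHom.toMultiplicative : Multiplicative ℝ≥0 →* Multiplicative ℝ)).comp
      (MonGp.map dX))
  (δY : ((RealificationData.canonical (arithDivisorFunctor F K) (PreFrobenioid.IsPerfFactorialOn.op hΦ)).realSpan
        (PreFrobenioid.biratSubfunctor
          (ModelFrobenioid.toElem (arithDivisorFunctor F K) (unitsFunctor F K) (divNatTrans F K)))).Pic Y →*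
      Multiplicative ℝ)
  (hδY : δY.comp (QuotientGroup.mk' _) =
    (Algebra.GrothendieckGroup.lift
      (NNReal.toRealHom.toAddMonoidHom.toMultiplicative : Multiplicative ℝ≥0 →* Multiplicative ℝ)).comp
      (MonGp.map dY))
include hδX hδY

/-- **`δ_X (Pic(f) x) = (δ_Y x)^{[L_X : L_Y]}`** — the descended degrees along the pull-back
`Pic(f) : Pic_Φ(Y) → Pic_Φ(X)` (abc-iut-L1-t5's `GpSubfunctor.picPull`, induced by `Φ^rlf(f)`), multiplicatively.
[cite: MochizukiFrdI2008, Thm. 6.4 (ii) p.114] -/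
theorem arith_picDegree_picPull
    (x : ((RealificationData.canonical (arithDivisorFunctor F K) (PreFrobenioid.IsPerfFactorialOn.op hΦ)).realSpan
        (PreFrobenioid.biratSubfunctor
          (ModelFrobenioid.toElem (arithDivisorFunctor F K) (unitsFunctor F K) (divNatTrans F K)))).Pic Y) :
    δX (((RealificationData.canonical (arithDivisorFunctor F K) (PreFrobenioid.IsPerfFactorialOn.op hΦ)).realSpan
        (PreFrobenioid.biratSubfunctor
          (ModelFrobenioid.toElem (arithDivisorFunctor F K) (unitsFunctor F K) (divNatTrans F K)))).picPull f x) =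
      δY x ^ (letI := f.toAlgHom.toRingHom.toAlgebra; Module.finrank Y.L X.L) := by
  obtain ⟨ξ, rfl⟩ := QuotientGroup.mk'_surjective _ x
  -- both sides are homomorphisms in `ξ ∈ (Φ^rlf)^gp(L_Y)`; compare on generators `[a]`, `a ∈ Φ(L_Y)^rlf`
  suffices h : (δX.comp (((RealificationData.canonical (arithDivisorFunctor F K)
      (PreFrobenioid.IsPerfFactorialOn.op hΦ)).realSpan (PreFrobenioid.biratSubfunctor
        (ModelFrobenioid.toElem (arithDivisorFunctor F K) (unitsFunctor F K) (divNatTrans F K)))).picPull f)).comp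
        (QuotientGroup.mk' _) =
      (powMonoidHom (letI := f.toAlgHom.toRingHom.toAlgebra; Module.finrank Y.L X.L)).comp
        (δY.comp (QuotientGroup.mk' _)) from DFunLike.congr_fun h ξ
  refine MonGp.hom_ext fun a => ?_
  show δX (((RealificationData.canonical (arithDivisorFunctor F K) (PreFrobenioid.IsPerfFactorialOn.op hΦ)).realSpan
      (PreFrobenioid.biratSubfunctor
        (ModelFrobenioid.toElem (arithDivisorFunctor F K) (unitsFunctor F K) (divNatTrans F K)))).picPull f
      (QuotientGroup.mk' _ (Algebra.GrothendieckGroup.of a))) =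
    δY (QuotientGroup.mk' _ (Algebra.GrothendieckGroup.of a)) ^ _
  -- `Pic(f) [a] = [Φ^rlf(f) a]`
  have h1 : ((RealificationData.canonical (arithDivisorFunctor F K) (PreFrobenioid.IsPerfFactorialOn.op hΦ)).realSpan
      (PreFrobenioid.biratSubfunctor
        (ModelFrobenioid.toElem (arithDivisorFunctor F K) (unitsFunctor F K) (divNatTrans F K)))).picPull f
      (QuotientGroup.mk' _ (Algebra.GrothendieckGroup.of a)) =
      QuotientGroup.mk' _ (Algebra.GrothendieckGroup.of
        (rlfMap (arithDivisorFunctor F K) (PreFrobenioid.IsPerfFactorialOn.op hΦ) f.op a)) := by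
    show QuotientGroup.mk' _ (pullGp (RealificationData.canonical (arithDivisorFunctor F K)
      (PreFrobenioid.IsPerfFactorialOn.op hΦ)).rlf f (Algebra.GrothendieckGroup.of a)) = _
    exact congrArg _ (pullGp_of _ _)
  rw [h1]
  refine (arith_picDegree_mk_of hΦ X dX δX hδX
    (rlfMap (arithDivisorFunctor F K) (PreFrobenioid.IsPerfFactorialOn.op hΦ) f.op a)).trans ?_
  refine Eq.trans ?_ (congrArg (fun z => z ^ (letI := f.toAlgHom.toRingHom.toAlgebra; Module.finrank Y.L X.L))
    (arith_picDegree_mk_of hΦ Y dY δY hδY a)).symm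
  rw [arith_rlfDegree_comp_rlfMap hΦ f dX hdX dY hdY, toAdd_pow, nsmul_eq_mul, NNReal.coe_mul, NNReal.coe_natCast,
    ← ofAdd_nsmul, nsmul_eq_mul]

/-- **`δ_X (Pic(f) x) = [L_X : L_Y] · δ_Y x`** (additive reading): the descended degree scales by the degree of the
field extension under pull-back — the bookkeeping behind "ONE `deg(Ψ^rlf)` for all Frobenius-trivial objects" over
the connected base. [cite: MochizukiFrdI2008, Thm. 6.4 (ii) p.114] -/
theorem arith_toAdd_picDegree_picPull
    (x : ((RealificationData.canonical (arithDivisorFunctor F K) (PreFrobenioid.IsPerfFactorialOn.op hΦ)).realSpan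
        (PreFrobenioid.biratSubfunctor
          (ModelFrobenioid.toElem (arithDivisorFunctor F K) (unitsFunctor F K) (divNatTrans F K)))).Pic Y) :
    Multiplicative.toAdd (δX (((RealificationData.canonical (arithDivisorFunctor F K)
        (PreFrobenioid.IsPerfFactorialOn.op hΦ)).realSpan (PreFrobenioid.biratSubfunctor
          (ModelFrobenioid.toElem (arithDivisorFunctor F K) (unitsFunctor F K) (divNatTrans F K)))).picPull f x)) =
      (letI := f.toAlgHom.toRingHom.toAlgebra; Module.finrank Y.L X.L) * Multiplicative.toAdd (δY x) := by
  rw [arith_picDegree_picPull hΦ f dX hdX dY hdY δX hδX δY hδY, toAdd_pow, nsmul_eq_mul]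

end ArithRlfPic

end Literature.AlgebraicGeometry.Frobenioids

end
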